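import Mathlib.RingTheory.LocalRing.Module
import Mathlib.RingTheory.LocalRing.ResidueField.Basic
import Mathlib.RingTheory.Nakayama
import Mathlib.LinearAlgebra.Dual.Lemmas
import Mathlib.LinearAlgebra.FiniteDimensional.Basic
import HarnessLib

/-!
# The representing module `Q` of a two-term complex over a local ring is the residue field `k` when `Hom(Q, k)` is a line
# and no proper infinitesimal thickening `R⁄J` lifts it surjectively ([MumfordAV1970] §13 pp. 127–129; [EGAIII2] (7.7.6))

Layer `Literature/Algebra/Module`, namespace `Literature.Algebra.Module`.  THEOREMS ONLY (no definition, no named fact, no instance, no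
notation, no `sorry`), Mathlib only.  Cell `hodgecm-mathlib` (D-0151), brick (c-alg″) of the «H1-DIM-ANY-CHAR cut» (B-p04 memo v3): the
ALGEBRA of [MumfordAV1970] §13, proof of the Theorem, pp. 127–129 — «`Hom(Q, k) = H⁰(X, 𝒪_X) = k`, so `Q` is cyclic, `Q ≅ R⁄I`; if `I ≠ 𝔪`
the section lifts to `X × Spec(R⁄(I + 𝔪²))` … contradiction; hence `Q ≅ k`» — with the geometry abstracted into the hypothesis (h2).

Setting: `(R, 𝔪, k)` local with `𝔪` finitely generated (e.g. noetherian), `Q` a finitely generated `R`-module (in §3: `Q = Dual K⁰ ⧸ im d^∨`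
for a map `d : K⁰ → K¹` of finite free modules — the module representing `M ↦ H⁰(M ⊗ K•)`, ★ `TwoTermComplexBaseChange`,
★ `FreeComplexDoubleDualBaseChange` §4).

* §1 `exists_generator_of_finrank_hom_residueField_eq_one` — if `dim_k Hom_R(Q, k) = 1` then `Q = R·q₀` is CYCLIC and non-zero
  (`k ⊗_R Q` is a line, Mathlib `TensorProduct.mk_surjective` + Nakayama `IsLocalRing.map_tensorProduct_mk_eq_top`).
* §2 **`nonempty_linearEquiv_residueField_of_hom_thickening_tests`** — if moreover for every ideal `J` with `𝔪·𝔪 ≤ J ≤ 𝔪`, `J ≠ 𝔪`, the map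
  `Hom_R(Q, R⁄J) → Hom_R(Q, k)` (composition with `R⁄J ↠ k`) is NOT surjective, then `Q ≃ₗ[R] k`.  (With `Q ≅ R⁄I`, `I ≤ 𝔪`, take
  `J := I + 𝔪·𝔪`: `Q ↠ R⁄J ↠ k` is a non-zero element of the line `Hom_R(Q, k)` in the image, so the image is everything; hence `J = 𝔪`, and
  Nakayama gives `I = 𝔪`.)
* §3 **`exists_residueField_surjective_exact_lcomp_of_hom_thickening_tests`** — the two-term-complex form: for `d : K⁰ →ₗ[R] K¹` with `K⁰`
  finite free and `Q := Dual R K⁰ ⧸ range d.dualMap` satisfying (h1)(h2), there is `ε : Dual R K⁰ ↠ k` with `Exact (lcomp R R d) ε` — the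
  hypotheses `(ε, hε, h₁)` of ★ `FreeComplexDoubleDualBaseChange.finrank_HOne_baseChangeComplex_residueField_eq_finrank_cotangentSpace`.

HC_CM is proved only modulo the 7 printed citations until rung 0 closes; nothing here bears on a summit statement (count-neutral capital).

## References
* [MumfordAV1970] D. Mumford, *Abelian Varieties* (1970), §13, proof of the Theorem (pp. 127–129).
* [EGAIII2] A. Grothendieck, *EGA III₂* (1963), (7.7.6) (the representing module `Q`).
* [AtiyahMacdonald1969] M. F. Atiyah, I. G. Macdonald, *Introduction to Commutative Algebra* (1969), Prop. 2.6, Cor. 2.7 and Prop. 2.8 (pp. 21–22) (Nakayama).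
-/

set_option autoImplicit false

universe u v

open IsLocalRing TensorProduct Module

namespace Literature.Algebra.Module

/-! ## §1 A finitely generated module with a one-dimensional `Hom(Q, k)` is cyclic -/

section Cyclic

variable {R : Type u} [CommRing R] [IsLocalRing R] {Q : Type v} [AddCommGroup Q] [Module R Q]

/-- `Hom_R(Q, k) ≃ₗ[k] Dual_k (k ⊗_R Q)` (hom-tensor adjunction for the residue field `k`). [cite: AtiyahMacdonald1969, Prop. 2.8 (p. 22)] -/
theorem nonempty_hom_residueField_linearEquiv_dual_tensor :
    Nonempty ((Q →ₗ[R] ResidueField R) ≃ₗ[ResidueField R] Module.Dual (ResidueField R) (ResidueField R ⊗[R] Q)) := by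
  refine ⟨?_⟩
  -- `(k ⊗[R] Q →ₗ[k] k) ≃ (k →ₗ[k] (Q →ₗ[R] k)) ≃ (Q →ₗ[R] k)`
  exact ((LinearMap.ringLmapEquivSelf (ResidueField R) (ResidueField R) (Q →ₗ[R] ResidueField R)).symm ≪≫ₗ
    (TensorProduct.AlgebraTensorModule.lift.equiv R (ResidueField R) (ResidueField R) (ResidueField R) Q (ResidueField R)))

/-- **`dim_k Hom_R(Q, k) = 1` forces `Q` CYCLIC AND NON-ZERO**: `k ⊗_R Q` is then a line, every element of `k ⊗_R Q` is `1 ⊗ q` (`R ↠ k`), so a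
non-zero `1 ⊗ q₀` spans it and `q₀` generates `Q` by Nakayama (Mathlib `IsLocalRing.map_tensorProduct_mk_eq_top`).
[cite: AtiyahMacdonald1969, Prop. 2.8 (p. 22)] [cite: MumfordAV1970, §13 (proof of the Theorem, pp. 127–129)] -/
theorem exists_generator_of_finrank_hom_residueField_eq_one [Module.Finite R Q]
    (h1 : Module.finrank (ResidueField R) (Q →ₗ[R] ResidueField R) = 1) :
    ∃ q₀ : Q, q₀ ≠ 0 ∧ Submodule.span R {q₀} = ⊤ := by
  classical
  set k := ResidueField R
  obtain ⟨e⟩ := nonempty_hom_residueField_linearEquiv_dual_tensor (R := R) (Q := Q)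
  -- `k ⊗ Q` is a line
  haveI : Module.Finite k (k ⊗[R] Q) := inferInstance
  have hdual : Module.finrank k (Module.Dual k (k ⊗[R] Q)) = 1 := by rw [← e.finrank_eq, h1]
  have hline : Module.finrank k (k ⊗[R] Q) = 1 := by rwa [Subspace.dual_finrank_eq] at hdual
  -- a non-zero vector, of the form `1 ⊗ q₀`
  obtain ⟨v, hv⟩ : ∃ v : k ⊗[R] Q, v ≠ 0 := by
    by_contra h
    push Not at h
    haveI : Subsingleton (k ⊗[R] Q) := ⟨fun a b => by rw [h a, h b]⟩
    have : Module.finrank k (k ⊗[R] Q) = 0 := Module.finrank_zero_of_subsingleton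
    omega
  obtain ⟨q₀, hq₀⟩ := TensorProduct.mk_surjective R Q k (IsLocalRing.residue_surjective) v
  refine ⟨q₀, ?_, ?_⟩
  · rintro rfl
    exact hv (by rw [← hq₀, map_zero])
  · -- `span_k {1 ⊗ q₀} = ⊤`, hence `span_R {q₀} = ⊤` by Nakayama
    have hspan_k : Submodule.span k {(TensorProduct.mk R k Q 1) q₀} = ⊤ := by
      rw [hq₀]
      exact (finrank_eq_one_iff_of_nonzero v hv).1 hline
    rw [← IsLocalRing.map_tensorProduct_mk_eq_top, Submodule.map_span, Set.image_singleton,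
      ← Submodule.restrictScalars_span R k IsLocalRing.residue_surjective, Submodule.restrictScalars_eq_top_iff, hspan_k]

end Cyclic

/-! ## §2 Thickening tests force `Q ≅ k` -/

section Tests

variable {R : Type u} [CommRing R] [IsLocalRing R] {Q : Type u} [AddCommGroup Q] [Module R Q]

/-- In `Hom_R(Q, k)` the `R`-action factors through `k`: `r • φ = residue r • φ`. [cite: AtiyahMacdonald1969, Prop. 2.8 (p. 22)] -/
theorem smul_hom_residueField_eq (r : R) (φ : Q →ₗ[R] ResidueField R) : r • φ = IsLocalRing.residue R r • φ := by
  ext q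
  rw [LinearMap.smul_apply, LinearMap.smul_apply, Algebra.smul_def, smul_eq_mul]
  rfl

/-- A non-zero element of the line `Hom_R(Q, k)` generates it as an `R`-module. [cite: AtiyahMacdonald1969, Prop. 2.8 (p. 22)] -/
theorem span_singleton_hom_residueField_eq_top (h1 : Module.finrank (ResidueField R) (Q →ₗ[R] ResidueField R) = 1)
    {φ : Q →ₗ[R] ResidueField R} (hφ : φ ≠ 0) : Submodule.span R {φ} = ⊤ := by
  have hk : Submodule.span (ResidueField R) {φ} = ⊤ := (finrank_eq_one_iff_of_nonzero φ hφ).1 h1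
  refine eq_top_iff.2 fun ψ _ => ?_
  have hψ : ψ ∈ Submodule.span (ResidueField R) {φ} := hk ▸ Submodule.mem_top
  obtain ⟨c, rfl⟩ := Submodule.mem_span_singleton.1 hψ
  obtain ⟨r, rfl⟩ := IsLocalRing.residue_surjective c
  rw [← smul_hom_residueField_eq]
  exact Submodule.smul_mem _ r (Submodule.mem_span_singleton_self φ)

/-- **THICKENING TESTS FORCE `Q ≅ k`** ([MumfordAV1970] §13 pp. 127–129, the algebra): `(R, 𝔪, k)` local with `𝔪` finitely generated, `Q`
finitely generated with `dim_k Hom_R(Q, k) = 1`; if for every ideal `J` with `𝔪·𝔪 ≤ J`, `J ≠ 𝔪`, and every `R`-linear `p : R⁄J → k` inducing the residue map (there is one iff `J ≤ 𝔪`),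
composition with `p` is NOT surjective `Hom_R(Q, R⁄J) → Hom_R(Q, k)`, then `Q ≃ₗ[R] k`.  Proof: `Q = R·q₀ ≅ R⁄I` (§1), `I ≤ 𝔪`; for `J := I ⊔ 𝔪·𝔪` the surjection
`Q ↠ R⁄J` composed with `R⁄J ↠ k` is non-zero, so the (line!) target is covered — contradiction unless `J = 𝔪`; then `𝔪 ≤ I ⊔ 𝔪·𝔪` and
Nakayama. [cite: MumfordAV1970, §13 (proof of the Theorem, pp. 127–129)] [cite: AtiyahMacdonald1969, Prop. 2.6 and Cor. 2.7 (p. 21)] -/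
theorem nonempty_linearEquiv_residueField_of_hom_thickening_tests [Module.Finite R Q] (hfg : (maximalIdeal R).FG)
    (h1 : Module.finrank (ResidueField R) (Q →ₗ[R] ResidueField R) = 1)
    (h2 : ∀ (J : Ideal R) (p : R ⧸ J →ₗ[R] ResidueField R), maximalIdeal R • maximalIdeal R ≤ J → J ≠ maximalIdeal R →
      (∀ r : R, p (Submodule.Quotient.mk r) = IsLocalRing.residue R r) →
      ¬ Function.Surjective (fun φ : Q →ₗ[R] R ⧸ J => p.comp φ)) :
    Nonempty (Q ≃ₗ[R] ResidueField R) := by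
  classical
  obtain ⟨q₀, hq₀ne, hq₀⟩ := exists_generator_of_finrank_hom_residueField_eq_one h1
  -- `Q ≅ R ⧸ I`, `I = ann(q₀) ≤ 𝔪`
  let π : R →ₗ[R] Q := LinearMap.toSpanSingleton R Q q₀
  have hπ : Function.Surjective π := by
    rw [← LinearMap.range_eq_top]
    change LinearMap.range (LinearMap.toSpanSingleton R Q q₀) = ⊤
    rw [LinearMap.range_toSpanSingleton, hq₀]
  let I : Ideal R := LinearMap.ker π
  have hIq : ∀ r : R, r ∈ I ↔ r • q₀ = 0 := fun r => LinearMap.mem_ker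
  have hIle : I ≤ maximalIdeal R := by
    refine IsLocalRing.le_maximalIdeal fun htop => hq₀ne ?_
    have h1I : (1 : R) ∈ I := htop ▸ Submodule.mem_top
    rw [hIq, one_smul] at h1I
    exact h1I
  let eI : Q ≃ₗ[R] R ⧸ I := (LinearMap.quotKerEquivOfSurjective π hπ).symm
  -- the thickening `J := I ⊔ 𝔪•𝔪`
  let J : Ideal R := I ⊔ maximalIdeal R • maximalIdeal R
  have hJ : J ≤ maximalIdeal R := sup_le hIle Submodule.smul_le_right
  have hmJ : maximalIdeal R • maximalIdeal R ≤ J := le_sup_right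
  have hIJ : I ≤ J := le_sup_left
  -- the canonical `p : R⁄J ↠ k`
  have hJker : J ≤ LinearMap.ker (Algebra.linearMap R (ResidueField R)) := fun r hr => by
    rw [LinearMap.mem_ker, Algebra.linearMap_apply]
    exact (Ideal.Quotient.eq_zero_iff_mem).2 (hJ hr)
  let pJ : R ⧸ J →ₗ[R] ResidueField R := J.liftQ (Algebra.linearMap R (ResidueField R)) hJker
  have hpJ : ∀ r : R, pJ (Submodule.Quotient.mk r) = IsLocalRing.residue R r := fun r => rfl
  -- `J = 𝔪`: otherwise the test (h2) fails, because `Q ↠ R⁄J ↠ k` is a non-zero element of the line `Hom_R(Q, k)` in the image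
  have hJeq : J = maximalIdeal R := by
    by_contra hne
    refine h2 J pJ hmJ hne hpJ ?_
    -- the lift `φJ : Q → R⁄J` of the canonical `φm : Q → k`
    let φJ : Q →ₗ[R] R ⧸ J := (Submodule.factor hIJ).comp eI.toLinearMap
    let φm : Q →ₗ[R] ResidueField R := pJ.comp φJ
    have hq : eI q₀ = Submodule.Quotient.mk 1 := by
      have h1 : eI.symm (Submodule.Quotient.mk 1) = q₀ := by
        change (LinearMap.quotKerEquivOfSurjective π hπ) (Submodule.Quotient.mk 1) = q₀
        rw [LinearMap.quotKerEquivOfSurjective_apply_mk]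
        change (1 : R) • q₀ = q₀
        exact one_smul R q₀
      rw [← h1, LinearEquiv.apply_symm_apply]
    have hφm1 : φm q₀ = 1 := by
      change pJ (Submodule.factor hIJ (eI q₀)) = 1
      rw [hq]
      change pJ (Submodule.Quotient.mk 1) = 1
      rw [hpJ, map_one]
    have hφm : φm ≠ 0 := by
      intro h0
      have : φm q₀ = 0 := by rw [h0, LinearMap.zero_apply]
      rw [hφm1] at this
      exact one_ne_zero this
    -- the image of composition is an `R`-submodule containing `φm`, hence everything
    intro ψ
    have hψ : ψ ∈ Submodule.span R {φm} := by
      rw [span_singleton_hom_residueField_eq_top h1 hφm]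
      exact Submodule.mem_top
    obtain ⟨r, rfl⟩ := Submodule.mem_span_singleton.1 hψ
    refine ⟨r • φJ, ?_⟩
    change pJ.comp (r • φJ) = r • φm
    rw [LinearMap.comp_smul]
  -- Nakayama: `𝔪 ≤ I ⊔ 𝔪•𝔪 ⇒ 𝔪 ≤ I`, so `I = 𝔪`
  have hNN : maximalIdeal R ≤ I ⊔ maximalIdeal R • maximalIdeal R :=
    calc maximalIdeal R = J := hJeq.symm
      _ ≤ I ⊔ maximalIdeal R • maximalIdeal R := le_rfl
  have hmI : maximalIdeal R ≤ I :=
    Submodule.le_of_le_smul_of_le_jacobson_bot hfg (IsLocalRing.maximalIdeal_le_jacobson ⊥) hNN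
  have hIeq : I = maximalIdeal R := le_antisymm hIle hmI
  exact ⟨eI ≪≫ₗ Submodule.quotEquivOfEq _ _ hIeq⟩

end Tests

/-! ## §3 The two-term complex form: `ε : Dual R K⁰ ↠ k` with `ker ε = im d^∨` -/

section TwoTerm

variable {R : Type u} [CommRing R] [IsLocalRing R] {K0 K1 : Type u} [AddCommGroup K0] [Module R K0] [AddCommGroup K1] [Module R K1]
  (d : K0 →ₗ[R] K1)

omit [IsLocalRing R] in
/-- `lcomp R R d = d.dualMap` on elements (both are precomposition with `d`). [cite: EGAIII2, (7.7.6)] -/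
theorem lcomp_eq_dualMap : LinearMap.lcomp R R d = d.dualMap := by
  ext φ x
  rfl

/-- **THE REPRESENTING MODULE IS THE RESIDUE FIELD, TWO-TERM FORM** ([MumfordAV1970] §13; [EGAIII2] (7.7.6)): for `d : K⁰ → K¹` with `K⁰` finite
free over a local `(R, 𝔪, k)` with `𝔪` finitely generated and `Q := Dual R K⁰ ⧸ range d^∨` (the module representing `M ↦ H⁰(M ⊗ K•)`), if
`dim_k Hom_R(Q, k) = 1` and no proper thickening test `Hom_R(Q, R⁄J) → Hom_R(Q, k)` (`𝔪·𝔪 ≤ J ≤ 𝔪`, `J ≠ 𝔪`) is surjective, then there is a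
SURJECTION `ε : Dual R K⁰ ↠ k` with `Exact (lcomp R R d) ε` (`ker ε = im d^∨`) — the inputs `(ε, hε, h₁)` of ★
`finrank_HOne_baseChangeComplex_residueField_eq_finrank_cotangentSpace`.
[cite: MumfordAV1970, §13 (proof of the Theorem, pp. 127–129)] [cite: EGAIII2, (7.7.6)] -/
theorem exists_residueField_surjective_exact_lcomp_of_hom_thickening_tests [Module.Finite R K0] [Module.Free R K0]
    (hfg : (maximalIdeal R).FG)
    (h1 : Module.finrank (ResidueField R) ((Module.Dual R K0 ⧸ LinearMap.range d.dualMap) →ₗ[R] ResidueField R) = 1)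
    (h2 : ∀ (J : Ideal R) (p : R ⧸ J →ₗ[R] ResidueField R), maximalIdeal R • maximalIdeal R ≤ J → J ≠ maximalIdeal R →
      (∀ r : R, p (Submodule.Quotient.mk r) = IsLocalRing.residue R r) →
      ¬ Function.Surjective (fun φ : (Module.Dual R K0 ⧸ LinearMap.range d.dualMap) →ₗ[R] R ⧸ J => p.comp φ)) :
    ∃ ε : Module.Dual R K0 →ₗ[R] ResidueField R, Function.Surjective ε ∧ Function.Exact (LinearMap.lcomp R R d) ε := by
  haveI : Module.Finite R (Module.Dual R K0 ⧸ LinearMap.range d.dualMap) := inferInstance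
  obtain ⟨e⟩ := nonempty_linearEquiv_residueField_of_hom_thickening_tests hfg h1 h2
  refine ⟨e.toLinearMap.comp (LinearMap.range d.dualMap).mkQ, ?_, ?_⟩
  · exact e.surjective.comp (Submodule.mkQ_surjective _)
  · rw [lcomp_eq_dualMap]
    intro φ
    constructor
    · intro h0
      have h0' : (LinearMap.range d.dualMap).mkQ φ = 0 := e.injective (by rw [map_zero]; exact h0)
      rwa [Submodule.mkQ_apply, Submodule.Quotient.mk_eq_zero, LinearMap.mem_range] at h0'
    · rintro ⟨ψ, rfl⟩
      change e ((LinearMap.range d.dualMap).mkQ (d.dualMap ψ)) = 0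
      rw [Submodule.mkQ_apply, (Submodule.Quotient.mk_eq_zero _).2 (LinearMap.mem_range_self _ ψ), map_zero]

end TwoTerm

end Literature.Algebra.Module
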